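import Mathlib.MeasureTheory.Measure.Haar.InnerProductSpace
import Summits.AtomisticToContinuum.HydrodynamicLimit.Theorems.CollisionIsometryCLTMacroClosureTwoScaleDefs
import Summits.AtomisticToContinuum.HydrodynamicLimit.Theorems.CollisionIsometryCLTMacroClosureTwoScaleCells
import Summits.AtomisticToContinuum.HydrodynamicLimit.Theorems.CollisionIsometryCLTMacroClosureCellsProductUpper
import Summits.AtomisticToContinuum.HydrodynamicLimit.Theorems.CollisionIsometryCLTMacroClosureFvCubeToTorus
import Literature.MathematicalPhysics.KineticTheory.HardSphereEulerProofs
import Literature.Analysis.FunctionSpaces.FlatTorusProofs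
import HarnessLib

/-!
# Volume of an occupation pattern of the hard-sphere gas (input of `stub_blockMGF_twoScale`,
line `IdeatorTwoGen1Sketch`, crux `MacroClosure`, stmt-AtomisticToContinuum-14870)

Proof file (`--supports stmt-AtomisticToContinuum-14870`) for the registered stub
`Barycentric.stub_twoScale_patternVolume`: the Haar volume of the labelled `d`-separated
configurations of `N + 1` sphere centres on `𝕋³` with prescribed occupation numbers `n κ` of the
`M³` cells (half-open cubes of side `1/M` with lower corners `x + κ/M`) of the `x`-shifted tiling is
at most the multinomial weight `(N+1)! / ∏ (n κ)!` times the product over the cells of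
`M^{-3 n κ} ·` (Lebesgue volume of the `n κ`-point configurations of the closed unit box `[0,1]³`
that are pairwise `d M`-separated in `ℝ³`).

Proof.
* The cells are measurable and pairwise disjoint (`stub_twoScale_cells`), and the occupation number
  `cellCount (1/M) (zipConfig (q, 0)) (x + κ/M)` of a cell is the number of labels `i` with `q i` in
  it, so the landed cells-product upper bound `stub_cellsProductUpper` (Ruelle 1969, §3.4) bounds
  the volume by the multinomial weight times the product of the single-cell constrained
  non-overlap volumes `vol {y : Fin (n κ) → 𝕋³ | yᵢ ∈ cell κ, dist(yᵢ, yⱼ) ≥ d}`.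
* PER-CELL SCALING (`TwoScalePatternVolume.cell_volume_le`): the chart `y ↦ (repr (yᵢ - c))ᵢ`
  (`c` the lower corner) is measure preserving from Haar measure on `(𝕋³)^m` to Lebesgue measure on
  `([0,1)³)^m` (`Torus.measurePreserving_repr`, translation invariance, `measurePreserving_pi`); it
  maps the cell constraint into the box `[0, ℓ]³` (`ℓ = 1/M`) and does not decrease separations,
  since the minimal-image distance is at most the distance of any two representatives
  (`Torus.euclidDist_proj_le_norm_sub_holds`). Hence the single-cell volume is at most the Lebesgue
  volume of the side-`ℓ` box constraint set at exclusion `d`, which lies in the `ℓ`-homothetic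
  image of the unit-box constraint set at exclusion `d/ℓ`, of volume `ℓ^{3m} ·` (unit-box volume)
  (`Measure.addHaar_smul`, through `FvCubeToTorus.volume_smul_set`).

Reference: D. Ruelle, *Statistical Mechanics: Rigorous Results* (1969), §3.4.
-/

noncomputable section

open MeasureTheory Filter Set Topology InformationTheory
open scoped ENNReal ContDiff Convolution Pointwise

namespace Summit.AtomisticToContinuum.HydrodynamicLimit.Theorems.MacroClosureLine

open Literature.MathematicalPhysics.KineticTheory Literature.Analysis.FluidPDE
open Literature.Analysis.FunctionSpaces

namespace Barycentric

namespace TwoScalePatternVolume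

/-! ### Lebesgue volume of the unit box -/

/-- The closed unit box `[0, 1]³ ⊆ ℝ³` has Lebesgue measure at most `1` (computed in `Fin 3 → ℝ`
through the volume-preserving `WithLp.ofLp`). [folklore] -/
theorem volume_unitBox_le_one : volume {v : V3 | ∀ l, 0 ≤ v l ∧ v l ≤ 1} ≤ 1 := by
  have h : {v : V3 | ∀ l, 0 ≤ v l ∧ v l ≤ 1} =
      WithLp.ofLp ⁻¹' Set.Icc (fun _ : Fin 3 => (0 : ℝ)) (fun _ => 1) := by
    ext v
    simp only [Set.mem_setOf_eq, Set.mem_preimage, Set.mem_Icc, Pi.le_def]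
    exact ⟨fun h => ⟨fun l => (h l).1, fun l => (h l).2⟩, fun h l => ⟨h.1 l, h.2 l⟩⟩
  rw [h, (PiLp.volume_preserving_ofLp (Fin 3)).measure_preimage
    measurableSet_Icc.nullMeasurableSet, Real.volume_Icc_pi]
  simp

/-- The unit-box constraint set of `(ℝ³)^m` (all points in `[0, 1]³`, pairwise `r`-separated)
has Lebesgue measure at most `1`; in particular it is finite. [folklore] -/
theorem volume_boxConstraint_le_one (m : ℕ) (r : ℝ) :
    volume {w : Fin m → V3 | (∀ i l, 0 ≤ w i l ∧ w i l ≤ 1) ∧ ∀ i j, i ≠ j → r ≤ ‖w i - w j‖} ≤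
      1 := by
  calc volume {w : Fin m → V3 | (∀ i l, 0 ≤ w i l ∧ w i l ≤ 1) ∧ ∀ i j, i ≠ j → r ≤ ‖w i - w j‖}
      ≤ volume (Set.univ.pi fun _ : Fin m => {v : V3 | ∀ l, 0 ≤ v l ∧ v l ≤ 1}) :=
        measure_mono fun w hw => Set.mem_univ_pi.2 fun i l => hw.1 i l
    _ = ∏ _i : Fin m, volume {v : V3 | ∀ l, 0 ≤ v l ∧ v l ≤ 1} := volume_pi_pi _
    _ ≤ 1 := by
        rw [Finset.prod_const, Finset.card_univ, Fintype.card_fin]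
        exact pow_le_one₀ bot_le volume_unitBox_le_one

/-! ### The chart of a cell and the scaling -/

/-- **The chart.** `y ↦ (repr (yᵢ - c))ᵢ` maps the set of `m` points of the half-open cube of
side `ℓ` with lower corner `c` that are pairwise `d`-separated on the torus into the Euclidean
constraint set `{v | v i l ∈ [0, ℓ], d ≤ ‖v i - v j‖ (i ≠ j)}` of `(ℝ³)^m`: the coordinates of
`repr` are nonnegative, and the minimal-image distance of two points is at most the distance of
any pair of representatives (`Torus.euclidDist_proj_le_norm_sub_holds`, `Torus.proj_repr`).
[folklore] -/
theorem subset_preimage_chart (m : ℕ) (c : T3) (ℓ d : ℝ) :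
    {y : Fin m → T3 | (∀ i, inCube ℓ (y i - c)) ∧
        ∀ i j, i ≠ j → d ≤ Torus.euclidDist (y i) (y j)} ⊆
      (fun (y : Fin m → T3) (i : Fin m) => Torus.repr (y i - c)) ⁻¹'
        {v : Fin m → V3 | (∀ i l, 0 ≤ v i l ∧ v i l ≤ ℓ) ∧ ∀ i j, i ≠ j → d ≤ ‖v i - v j‖} := by
  rintro y ⟨hin, hsep⟩
  refine ⟨fun i l => ⟨(Torus.repr_apply_mem_Ico _ l).1, (hin i l).le⟩, fun i j hij => ?_⟩
  calc d ≤ Torus.euclidDist (y i) (y j) := hsep i j hij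
    _ = Torus.euclidDist (Torus.proj (Torus.repr (y i - c)))
          (Torus.proj (Torus.repr (y j - c))) := by
        rw [Torus.proj_repr, Torus.proj_repr, Torus.euclidDist_eq, Torus.euclidDist_eq,
          sub_sub_sub_cancel_right]
    _ ≤ ‖Torus.repr (y i - c) - Torus.repr (y j - c)‖ :=
        Torus.euclidDist_proj_le_norm_sub_holds _ _

/-- **Scaling.** The side-`ℓ` box constraint set at exclusion `d` lies in the `ℓ`-homothetic
image of the unit-box constraint set at exclusion `d / ℓ` (`ℓ > 0`). [folklore] -/
theorem subset_smul_set (m : ℕ) {ℓ : ℝ} (d : ℝ) (hℓ : 0 < ℓ) :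
    {v : Fin m → V3 | (∀ i l, 0 ≤ v i l ∧ v i l ≤ ℓ) ∧ ∀ i j, i ≠ j → d ≤ ‖v i - v j‖} ⊆
      ℓ • {w : Fin m → V3 | (∀ i l, 0 ≤ w i l ∧ w i l ≤ 1) ∧
        ∀ i j, i ≠ j → d / ℓ ≤ ‖w i - w j‖} := by
  rintro v ⟨hv, hsep⟩
  refine Set.mem_smul_set.2 ⟨ℓ⁻¹ • v, ⟨fun i l => ?_, fun i j hij => ?_⟩, smul_inv_smul₀ hℓ.ne' v⟩
  · rw [Pi.smul_apply, PiLp.smul_apply, smul_eq_mul]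
    exact ⟨mul_nonneg (inv_nonneg.2 hℓ.le) (hv i l).1,
      by rw [inv_mul_le_iff₀ hℓ, mul_one]; exact (hv i l).2⟩
  · rw [Pi.smul_apply, Pi.smul_apply, ← smul_sub, norm_smul,
      Real.norm_of_nonneg (inv_nonneg.2 hℓ.le), div_eq_inv_mul]
    exact mul_le_mul_of_nonneg_left (hsep i j hij) (inv_nonneg.2 hℓ.le)

/-- **Per-cell scaling.** For a lower corner `c ∈ 𝕋³`, a side `ℓ > 0` and an exclusion `d`, the
Haar volume of the `m`-point configurations of the half-open cube `{y | repr (y - c) ∈ [0, ℓ)³}`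
that are pairwise at minimal-image distance `≥ d` is at most `ℓ^{3m}` times the Lebesgue volume of
the `m`-point configurations of the closed unit box `[0, 1]³ ⊆ ℝ³` that are pairwise at Euclidean
distance `≥ d / ℓ` (chart `y ↦ (repr (yᵢ - c))ᵢ`, measure preserving onto `([0,1)³)^m` and
separation non-decreasing; then the Lebesgue scaling `vol (ℓ • A) = ℓ^{3m} vol A`).
[cite: Ruelle1969, §3.4] -/
theorem cell_volume_le (m : ℕ) (c : T3) (ℓ d : ℝ) (hℓ : 0 < ℓ) :
    (volume {y : Fin m → T3 | (∀ i, inCube ℓ (y i - c)) ∧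
        ∀ i j, i ≠ j → d ≤ Torus.euclidDist (y i) (y j)}).toReal ≤
      ℓ ^ (3 * m) * (volume {w : Fin m → V3 | (∀ i l, 0 ≤ w i l ∧ w i l ≤ 1) ∧
        ∀ i j, i ≠ j → d / ℓ ≤ ‖w i - w j‖}).toReal := by
  set B₁ : Set (Fin m → V3) := {w | (∀ i l, 0 ≤ w i l ∧ w i l ≤ 1) ∧
    ∀ i j, i ≠ j → d / ℓ ≤ ‖w i - w j‖} with hB₁
  set B : Set (Fin m → V3) := {v | (∀ i l, 0 ≤ v i l ∧ v i l ≤ ℓ) ∧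
    ∀ i j, i ≠ j → d ≤ ‖v i - v j‖} with hB
  -- the chart is measure preserving onto Lebesgue measure on `([0,1)³)^m`
  have hR : MeasurePreserving (fun (y : Fin m → T3) (i : Fin m) => Torus.repr (y i - c))
      (volume : Measure (Fin m → T3))
      (Measure.pi fun _ : Fin m => (volume : Measure V3).restrict (Torus.unitCube (Fin 3))) :=
    measurePreserving_pi (fun _ : Fin m => (volume : Measure T3))
      (fun _ => (volume : Measure V3).restrict (Torus.unitCube (Fin 3)))
      (f := fun (_ : Fin m) (y : T3) => Torus.repr (y - c))
      fun _ => Torus.measurePreserving_repr.comp (measurePreserving_sub_right volume c)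
  have key : volume {y : Fin m → T3 | (∀ i, inCube ℓ (y i - c)) ∧
      ∀ i j, i ≠ j → d ≤ Torus.euclidDist (y i) (y j)} ≤ ENNReal.ofReal (ℓ ^ (3 * m)) * volume B₁ :=
    calc volume {y : Fin m → T3 | (∀ i, inCube ℓ (y i - c)) ∧
          ∀ i j, i ≠ j → d ≤ Torus.euclidDist (y i) (y j)}
        ≤ volume ((fun (y : Fin m → T3) (i : Fin m) => Torus.repr (y i - c)) ⁻¹' B) :=
          measure_mono (subset_preimage_chart m c ℓ d)
      _ ≤ Measure.map (fun (y : Fin m → T3) (i : Fin m) => Torus.repr (y i - c)) volume B :=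
          Measure.le_map_apply hR.measurable.aemeasurable B
      _ = (volume : Measure (Fin m → V3)).restrict
            (Set.univ.pi fun _ : Fin m => Torus.unitCube (Fin 3)) B := by
          rw [hR.map_eq, show (volume : Measure (Fin m → V3)) = Measure.pi fun _ => volume from rfl,
            Measure.restrict_pi_pi]
      _ ≤ volume B := Measure.restrict_apply_le _ _
      _ ≤ volume (ℓ • B₁) := measure_mono (subset_smul_set m d hℓ)
      _ = ENNReal.ofReal (ℓ ^ (3 * m)) * volume B₁ := FvCubeToTorus.volume_smul_set m hℓ.le B₁
  have hfin : ENNReal.ofReal (ℓ ^ (3 * m)) * volume B₁ ≠ ⊤ :=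
    ENNReal.mul_ne_top ENNReal.ofReal_ne_top
      (ne_top_of_le_ne_top ENNReal.one_ne_top (volume_boxConstraint_le_one m (d / ℓ)))
  have h := ENNReal.toReal_mono hfin key
  rwa [ENNReal.toReal_mul, ENNReal.toReal_ofReal (pow_nonneg hℓ.le _)] at h

end TwoScalePatternVolume

open TwoScalePatternVolume in
/-- **Volume of an occupation pattern** (registered stub `stub_twoScale_patternVolume`): for the
`x`-shifted tiling of `𝕋³` into the `M³` half-open cubes of side `1/M` with lower corners
`x + κ/M`, occupation numbers `n κ` with `∑ n κ = N + 1` and an exclusion distance `d ≥ 0`, the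
Haar volume of the labelled `d`-separated position configurations `q : Fin (N+1) → 𝕋³` with
exactly `n κ` sphere centres in the cell `κ` is at most
`(N+1)! / ∏ (n κ)! · ∏_κ M^{-3 n κ} vol {w : Fin (n κ) → [0,1]³ | ‖wᵢ - wⱼ‖ ≥ d M (i ≠ j)}`
(cells-product upper bound `stub_cellsProductUpper` for the disjoint measurable cells of
`stub_twoScale_cells`, then the per-cell scaling `TwoScalePatternVolume.cell_volume_le`).
[cite: Ruelle1969, §3.4] -/
theorem stub_twoScale_patternVolume : ∀ (M : ℕ), 0 < M → ∀ (x : T3) (N : ℕ) (d : ℝ), 0 ≤ d →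
    ∀ (n : (Fin 3 → Fin M) → ℕ), ∑ κ, n κ = N + 1 →
    (volume ({q : Fin (N + 1) → T3 | ∀ κ : Fin 3 → Fin M,
        cellCount ((M : ℝ)⁻¹) (zipConfig (q, fun _ => (0 : V3))) (x + Torus.proj (Torus.cellCorner M κ)) = n κ} ∩
      posDomain d (N + 1))).toReal ≤
    ((N + 1).factorial : ℝ) / (∏ κ, ((n κ).factorial : ℝ)) *
      ∏ κ : Fin 3 → Fin M, (((M : ℝ)⁻¹) ^ (3 * n κ) *
        (volume {w : Fin (n κ) → V3 | (∀ i l, 0 ≤ w i l ∧ w i l ≤ 1) ∧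
          ∀ i j, i ≠ j → d / (M : ℝ)⁻¹ ≤ ‖w i - w j‖}).toReal) := by
  intro M hM x N d _ n hn
  obtain ⟨hmeas, hdisj, -, -⟩ := stub_twoScale_cells M hM x
  -- the cells of the shifted tiling
  set C : (Fin 3 → Fin M) → Set T3 := fun κ =>
    {y : T3 | inCube ((M : ℝ)⁻¹) (y - (x + Torus.proj (Torus.cellCorner M κ)))} with hC
  -- the cells-product upper bound for these cells
  have hA := stub_cellsProductUpper (Fin (N + 1)) (Fin 3 → Fin M) C n d hmeas hdisj
    (by rw [Fintype.card_fin]; exact hn)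
  rw [Fintype.card_fin] at hA
  -- the occupation numbers of the cells are the cell counts
  have hcount : ∀ (q : Fin (N + 1) → T3) (κ : Fin 3 → Fin M),
      cellCount ((M : ℝ)⁻¹) (zipConfig (q, fun _ => (0 : V3)))
          (x + Torus.proj (Torus.cellCorner M κ)) = {i | q i ∈ C κ}.ncard := by
    intro q κ
    rw [cellCount, ← Set.ncard_coe_finset]
    congr 1
    ext i
    simp [cellSet, hC]
  have hset : ({q : Fin (N + 1) → T3 | ∀ κ : Fin 3 → Fin M,
        cellCount ((M : ℝ)⁻¹) (zipConfig (q, fun _ => (0 : V3)))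
          (x + Torus.proj (Torus.cellCorner M κ)) = n κ} ∩ posDomain d (N + 1)) =
      {q : Fin (N + 1) → T3 | (∀ j, {i | q i ∈ C j}.ncard = n j) ∧
        ∀ i i', i ≠ i' → d ≤ Torus.euclidDist (q i) (q i')} := by
    ext q
    simp only [Set.mem_inter_iff, Set.mem_setOf_eq, posDomain, hcount]
  rw [hset]
  -- multiply the per-cell scaling bounds
  have hM' : (0 : ℝ) < (M : ℝ)⁻¹ := inv_pos.2 (by exact_mod_cast hM)
  refine hA.trans (mul_le_mul_of_nonneg_left ?_
    (div_nonneg (Nat.cast_nonneg _) (Finset.prod_nonneg fun _ _ => Nat.cast_nonneg _)))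
  refine Finset.prod_le_prod (fun κ _ => ENNReal.toReal_nonneg) fun κ _ => ?_
  exact cell_volume_le (n κ) (x + Torus.proj (Torus.cellCorner M κ)) ((M : ℝ)⁻¹) d hM'

end Barycentric

end Summit.AtomisticToContinuum.HydrodynamicLimit.Theorems.MacroClosureLine

end
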